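import Literature.InformationTheory.Entanglement.QuantumFisherInformationBiseparableBound
import Literature.InformationTheory.StateDiscrimination.WignerYanaseSkewInformation
import HarnessLib

/-!
# Wigner–Yanase skew information as an entanglement test (Chen 2005): `I(ρ_sep, Σ_j σ^{(j)}) ≤ n`,
# `I(ρ, Σ_j σ^{(j)}) ≤ n²`, `I(|GHZ⟩, Σ_j σ_z^{(j)}) = n²`, and `I > (n−1)² + 1 ⟹` fully entangled

Hodge foundations lane (`lit-hodgefound`, prover p24 gen 79; quantum-information series, file 7).  THEOREMS
ONLY: no definition, no named fact, net debt 0.  Vocabulary: the Wigner–Yanase skew information SPELLED OUT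
as in `WignerYanaseSkewInformation.lean` (g79-#4), `I(ρ, A) = Re[Tr(ρA²) − Tr(√ρ A √ρ A)]` with Mathlib's
`CFC.sqrt ρ`; the `N`-qubit register `Fin N → Bool` with `localPauli`, `collectiveSpin`
(`SpinSqueezingCriterion.lean`), `IsSeparable` (fully separable), `IsBiseparable` / GME (`GHZFidelityWitness.lean`),
`ghzN`; the local spin observables of the source are taken along one Pauli axis, `A_j = σ_l^{(j)}`, so that
`A_1 + … + A_n = Σ_j σ_l^{(j)} = 2J_l`.

## Source (read verbatim)

Z. Chen, *Wigner-Yanase skew information as tests for quantum entanglement*, Phys. Rev. A **71** (2005) 052302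
= arXiv:quant-ph/0412092 [Chen2005SkewInformationEntanglement]: «`I(ρ, A) = tr ρA² − tr ρ^{1/2}Aρ^{1/2}A` (4)
… if `ρ = |ψ⟩⟨ψ|` is a pure state, then `I(|ψ⟩, A) = ⟨ψ|A²|ψ⟩ − ⟨ψ|A|ψ⟩²` (5).  From Eqs. (2) and (5) one
concludes that `I(ρ, A) ≤ 1` (6) for each spin observable `A` (`A² = 1`) in all states `ρ`.»  «`I(ρ, A_1 + ⋯ +
A_n) ≤ n` (7) for all separable states `ρ` of the `n` particles. (We write `A_1`, etc., as shorthand for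
`A_1 ⊗ 1 ⊗ ⋯ ⊗ 1`.)»  «`I(ρ, A_1 + ⋯ + A_n) ≤ n²` (8) for all (entangled) states … Equality in Eq. (8) can be
attained … by the GHZ state … choosing `A_j = σ_z^j` … `I(|GHZ⟩, σ_z^1 + ⋯ + σ_z^n) = n²` (9).»  «a state of `n`
particles is fully entangled, if it cannot be written as `ρ_{(k)} ⊗ ρ_{(n−k)}` or mixtures of these states …
`E_{n−1} = (n−1)² + 1` … if `I(ρ) > (n−1)² + 1`, then `ρ` is fully entangled.»

## Road (the tree's, shorter than the printed additivity argument)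

Luo's `I_W ≤ I_F = F_Q/4` (`WignerYanase.four_skewInfo_le_qfi`, for the SLD supplied by
`QFIVariance.exists_sld_unitaryDeriv`) transfers the QFI bounds already in the tree — Pezzè–Smerzi
`QFICriterion.qfi_le_of_isSeparable` (`F_Q[ρ_sep, J_l] ≤ N`), the Heisenberg limit
`QFICriterion.qfi_collectiveSpin_le_sq` (`≤ N²`), and Tóth's `QFIBiseparable.qfi_le_of_isBiseparable`
(`≤ (N−1)² + 1`) — to the skew information of `Σ_j σ_l^{(j)} = 2J_l` by the scaling `I(ρ, cA) = c²I(ρ, A)`; the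
GHZ value is the pure-state variance (5) (`WignerYanase.skewInfo_pure_eq_variance` and
`QFICriterion.variance_ghzN_collectiveSpin_Z`).  Tóth 2012 notes the kinship («A condition similar to Eq. (Nka-2)
has appeared in Ref. [C05] for the Wigner-Yanase skew information»).

## What is formalized (all PROVED)

`posSemidef_of_isSeparable`, `trace_of_isSeparable`, `posSemidef_of_isBiseparable`, `trace_of_isBiseparable` (the
tree's decompositions are states); `skewInfo_smul` (`I(ρ, cA) = c²I(ρ, A)`), `sum_localPauli_eq`
(`Σ_j σ_l^{(j)} = 2J_l`); **`skewInfo_le_one`** ((6)); **`skewInfo_le_of_isSeparable`** ((7) for `A_j = σ_l^{(j)}`),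
`not_isSeparable_of_skewInfo_gt`; **`skewInfo_le_sq`** ((8)); **`skewInfo_ghzN`** ((9)); **`skewInfo_le_of_isBiseparable`**
(`E_{n−1} = (n−1)² + 1` on biseparable states) and **`not_isBiseparable_of_skewInfo_gt`** («if `I(ρ) > (n−1)² + 1`,
then `ρ` is fully entangled»).

NOT formalized: local spin observables along arbitrary, site-dependent directions `A_j = n_j·σ⃗` (only the
collective axes `σ_x, σ_y, σ_z`) — `TODO(general form)`; the intermediate classes `E_k`, `2 ≤ k ≤ n−2`
(`k`-producibility is not in the tree's vocabulary); Gisin's-theorem exactness for two qubits; the Werner–GHZ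
family (15).  Tree search (FAIL-DUP, 2026-09-01): `rg -n "skew" Literature/InformationTheory/Entanglement` → no hit;
`WignerYanaseSkewInformation.lean` (StateDiscrimination) has Luo's inequalities only.
-/

noncomputable section

open scoped BigOperators ComplexOrder MatrixOrder ComplexConjugate NNReal
open Matrix Complex Finset
open Literature.Computability.QuantumComplexity
open Literature.InformationTheory.Entanglement.Tsirelson
open Literature.InformationTheory.StateDiscrimination

namespace Literature.InformationTheory.Entanglement

namespace SkewInfoCriterion

open SpinSqueezing GHZWitness MerminKlyshkoGHZ UnentangledSpins QFICriterion QFIBiseparable WignerYanase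

variable {N : ℕ}

/-! ## § 1 The decompositions of the tree are states -/

/-- A mixture `Σ_k p_k|ψ_k⟩⟨ψ_k|` with `p_k ≥ 0` is positive semidefinite. [folklore] -/
private theorem posSemidef_mixture {ι : Type*} [Fintype ι] {p : ι → ℝ} (hp : ∀ k, 0 ≤ p k)
    (ψ : ι → (Fin N → Bool) → ℂ) : (∑ k, (p k : ℂ) • vecMulVec (ψ k) (star (ψ k))).PosSemidef :=
  Finset.sum_induction _ (fun M : Matrix (Fin N → Bool) (Fin N → Bool) ℂ => M.PosSemidef) (fun _ _ ha hb => ha.add hb)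
    PosSemidef.zero
    fun k _ => (posSemidef_vecMulVec_self_star (ψ k)).smul (Complex.zero_le_real.mpr (hp k))

/-- A mixture `Σ_k p_k|ψ_k⟩⟨ψ_k|` of unit vectors with `Σ p_k = 1` has trace `1`. [folklore] -/
private theorem trace_mixture {ι : Type*} [Fintype ι] {p : ι → ℝ} (h1 : ∑ k, p k = 1)
    {ψ : ι → (Fin N → Bool) → ℂ} (hψ : ∀ k, star (ψ k) ⬝ᵥ ψ k = 1) :
    (∑ k, (p k : ℂ) • vecMulVec (ψ k) (star (ψ k))).trace = 1 := by
  rw [trace_sum]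
  simp_rw [trace_smul, trace_vecMulVec, dotProduct_comm _ (star _), hψ, smul_eq_mul, mul_one]
  rw [← Complex.ofReal_sum, h1, Complex.ofReal_one]

/-- A fully separable state of the register is positive semidefinite. [cite: Chen2005SkewInformationEntanglement,
p. 2 («separable states are written as a convex sum over the states `ρ_1 ⊗ ⋯ ⊗ ρ_n`»)] -/
theorem posSemidef_of_isSeparable {ρ : Matrix (Fin N → Bool) (Fin N → Bool) ℂ} (hρ : IsSeparable ρ) :
    ρ.PosSemidef := by
  obtain ⟨ι, _, p, ψ, hp, -, -, rfl⟩ := hρ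
  exact posSemidef_mixture hp ψ

/-- A fully separable state of the register has unit trace. [cite: Chen2005SkewInformationEntanglement, p. 2] -/
theorem trace_of_isSeparable {ρ : Matrix (Fin N → Bool) (Fin N → Bool) ℂ} (hρ : IsSeparable ρ) : ρ.trace = 1 := by
  obtain ⟨ι, _, p, ψ, -, h1, hψ, rfl⟩ := hρ
  refine trace_mixture h1 fun k => ?_
  obtain ⟨φ, hφ, hk⟩ := hψ k
  rw [hk]; exact productVec_norm hφ

/-- A biseparable state of the register is positive semidefinite. [cite: Chen2005SkewInformationEntanglement, p. 3
(«`ρ_{(k)} ⊗ ρ_{(n−k)}` or mixtures of these states»)] -/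
theorem posSemidef_of_isBiseparable {ρ : Matrix (Fin N → Bool) (Fin N → Bool) ℂ} (hρ : IsBiseparable ρ) :
    ρ.PosSemidef := by
  obtain ⟨ι, _, p, ψ, hp, -, -, -, rfl⟩ := hρ
  exact posSemidef_mixture hp ψ

/-- A biseparable state of the register has unit trace. [cite: Chen2005SkewInformationEntanglement, p. 3] -/
theorem trace_of_isBiseparable {ρ : Matrix (Fin N → Bool) (Fin N → Bool) ℂ} (hρ : IsBiseparable ρ) :
    ρ.trace = 1 := by
  obtain ⟨ι, _, p, ψ, -, h1, hψ, -, rfl⟩ := hρ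
  exact trace_mixture h1 hψ

/-! ## § 2 Scaling, the spin-observable bound (6), and `Σ_j σ_l^{(j)} = 2J_l` -/

/-- **`I(ρ, cA) = c²I(ρ, A)`** for real `c`. [cite: Chen2005SkewInformationEntanglement, eq. (4)] -/
theorem skewInfo_smul {n : Type*} [Fintype n] [DecidableEq n] (ρ A : Matrix n n ℂ) (c : ℝ) :
    ((ρ * (((c : ℂ) • A) * ((c : ℂ) • A))).trace - (CFC.sqrt ρ * ((c : ℂ) • A) * CFC.sqrt ρ * ((c : ℂ) • A)).trace).re =
      c ^ 2 * ((ρ * (A * A)).trace - (CFC.sqrt ρ * A * CFC.sqrt ρ * A).trace).re := by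
  simp only [Matrix.smul_mul, Matrix.mul_smul, smul_smul, trace_smul, smul_eq_mul]
  rw [← mul_sub, ← Complex.ofReal_mul, Complex.re_ofReal_mul, sq]

/-- **Chen (6): `I(ρ, A) ≤ 1` for a spin observable (`A² = 𝟙`, `A` Hermitian) in every state** —
`I ≤ (ΔA)² ≤ ⟨A²⟩ = 1`. [cite: Chen2005SkewInformationEntanglement, eq. (6)] -/
theorem skewInfo_le_one {n : Type*} [Fintype n] [DecidableEq n] {ρ A : Matrix n n ℂ} (hρ : ρ.PosSemidef)
    (hρ1 : ρ.trace = 1) (hA : A.IsHermitian) (hA2 : A * A = 1) :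
    ((ρ * (A * A)).trace - (CFC.sqrt ρ * A * CFC.sqrt ρ * A).trace).re ≤ 1 := by
  have h := skewInfo_le_variance hρ hρ1 hA
  rw [hA2, Matrix.mul_one, hρ1, Complex.one_re] at h
  rw [hA2, Matrix.mul_one, hρ1]
  nlinarith [sq_nonneg (ρ * A).trace.re]

/-- `A_1 + ⋯ + A_n = Σ_j σ_l^{(j)} = 2J_l` for the collective axis `l`. [cite: Chen2005SkewInformationEntanglement,
eq. (7) («We write `A_1`, etc., as shorthand for `A_1 ⊗ 1 ⊗ ⋯ ⊗ 1`»)] -/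
theorem sum_localPauli_eq (l : Pauli) (N : ℕ) :
    ∑ i : Fin N, localPauli l i = (((2 : ℝ)) : ℂ) • collectiveSpin l N := by
  rw [collectiveSpin_eq_smul_sum, smul_smul]
  norm_num

/-- The bridge: `I(ρ, Σ_j σ_l^{(j)}) = 4·I(ρ, J_l) ≤ F_Q[ρ, J_l]` for every Hermitian SLD along `J_l` (Luo's
`I_W ≤ I_F`). [cite: Chen2005SkewInformationEntanglement, eq. (4)] -/
theorem skewInfo_sum_localPauli_le_qfi (l : Pauli) {ρ S : Matrix (Fin N → Bool) (Fin N → Bool) ℂ}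
    (hρ : ρ.PosSemidef) (hS : S.IsHermitian)
    (hSρ : S * ρ + ρ * S = Complex.I • (ρ * collectiveSpin l N - collectiveSpin l N * ρ)) :
    ((ρ * ((∑ i : Fin N, localPauli l i) * (∑ i : Fin N, localPauli l i))).trace -
        (CFC.sqrt ρ * (∑ i : Fin N, localPauli l i) * CFC.sqrt ρ * (∑ i : Fin N, localPauli l i)).trace).re ≤
      (2 * (S * (Complex.I • (ρ * collectiveSpin l N - collectiveSpin l N * ρ))).trace).re := by
  rw [sum_localPauli_eq, skewInfo_smul]
  have h := four_skewInfo_le_qfi hρ (collectiveSpin_isHermitian l N) hS hSρ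
  linarith

/-! ## § 3 Chen's inequalities (7), (8), (9) and the full-entanglement test -/

/-- **Chen (7) for the collective axes: `I(ρ, Σ_j σ_l^{(j)}) ≤ n` for every fully separable `n`-qubit state**
(`l ∈ {x, y, z}`).  Road: `I(ρ, 2J_l) = 4I(ρ, J_l) ≤ F_Q[ρ, J_l] ≤ N` (Luo, Pezzè–Smerzi).
[cite: Chen2005SkewInformationEntanglement, eq. (7)] -/
theorem skewInfo_le_of_isSeparable (l : Pauli) {ρ : Matrix (Fin N → Bool) (Fin N → Bool) ℂ} (hρ : IsSeparable ρ) :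
    ((ρ * ((∑ i : Fin N, localPauli l i) * (∑ i : Fin N, localPauli l i))).trace -
        (CFC.sqrt ρ * (∑ i : Fin N, localPauli l i) * CFC.sqrt ρ * (∑ i : Fin N, localPauli l i)).trace).re ≤ N := by
  -- TODO(general form): site-dependent directions `A_j = n_j·σ⃗` (any unit `n_j`), as printed.
  have hρ0 := posSemidef_of_isSeparable hρ
  obtain ⟨S, hS, hSρ⟩ := QFIVariance.exists_sld_unitaryDeriv hρ0 (collectiveSpin_isHermitian l N)
  exact (skewInfo_sum_localPauli_le_qfi l hρ0 hS hSρ).trans (qfi_le_of_isSeparable l hρ hS hSρ)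

/-- **Violation of (7) certifies entanglement** («a Bell-type inequality … which can be violated by entangled
states»). [cite: Chen2005SkewInformationEntanglement, eq. (7) and the following paragraph] -/
theorem not_isSeparable_of_skewInfo_gt (l : Pauli) {ρ : Matrix (Fin N → Bool) (Fin N → Bool) ℂ}
    (hgt : (N : ℝ) < ((ρ * ((∑ i : Fin N, localPauli l i) * (∑ i : Fin N, localPauli l i))).trace -
        (CFC.sqrt ρ * (∑ i : Fin N, localPauli l i) * CFC.sqrt ρ * (∑ i : Fin N, localPauli l i)).trace).re) :
    ¬ IsSeparable ρ :=
  fun hρ => absurd (skewInfo_le_of_isSeparable l hρ) (not_le.mpr hgt)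

/-- **Chen (8): `I(ρ, Σ_j σ_l^{(j)}) ≤ n²` for all states** (`ρ ⪰ 0`, `Tr ρ = 1`).  Road: `4I(ρ, J_l) ≤ F_Q[ρ, J_l] ≤ N²`
(Heisenberg limit). [cite: Chen2005SkewInformationEntanglement, eq. (8)] -/
theorem skewInfo_le_sq (l : Pauli) {ρ : Matrix (Fin N → Bool) (Fin N → Bool) ℂ} (hρ : ρ.PosSemidef)
    (hρ1 : ρ.trace = 1) :
    ((ρ * ((∑ i : Fin N, localPauli l i) * (∑ i : Fin N, localPauli l i))).trace -
        (CFC.sqrt ρ * (∑ i : Fin N, localPauli l i) * CFC.sqrt ρ * (∑ i : Fin N, localPauli l i)).trace).re ≤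
      (N : ℝ) ^ 2 := by
  obtain ⟨S, hS, hSρ⟩ := QFIVariance.exists_sld_unitaryDeriv hρ (collectiveSpin_isHermitian l N)
  exact (skewInfo_sum_localPauli_le_qfi l hρ hS hSρ).trans (qfi_collectiveSpin_le_sq l hρ hρ1 hS hSρ)

/-- **Chen (9): `I(|GHZ⟩, σ_z^1 + ⋯ + σ_z^n) = n²`** (`n ≥ 1`) — equality in (8): for the pure GHZ state the skew
information is the variance (5), `⟨GHZ|Σσ_z|GHZ⟩ = 0` and `(Σσ_z)²|GHZ⟩ = n²|GHZ⟩`. [cite: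
Chen2005SkewInformationEntanglement, eq. (9)] -/
theorem skewInfo_ghzN [NeZero N] :
    ((vecMulVec (ghzN N) (star (ghzN N)) * ((∑ i : Fin N, localPauli Pauli.Z i) * (∑ i : Fin N, localPauli Pauli.Z i))).trace -
        (CFC.sqrt (vecMulVec (ghzN N) (star (ghzN N))) * (∑ i : Fin N, localPauli Pauli.Z i) *
          CFC.sqrt (vecMulVec (ghzN N) (star (ghzN N))) * (∑ i : Fin N, localPauli Pauli.Z i)).trace).re =
      (N : ℝ) ^ 2 := by
  rw [sum_localPauli_eq, skewInfo_smul, skewInfo_pure_eq_variance ghzN_norm]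
  have hv := variance_ghzN_collectiveSpin_Z (N := N)
  rw [variance, vecState_apply, vecState_apply] at hv
  have hreal : star (ghzN N) ⬝ᵥ (collectiveSpin Pauli.Z N *ᵥ ghzN N) =
      ((star (ghzN N) ⬝ᵥ (collectiveSpin Pauli.Z N *ᵥ ghzN N)).re : ℂ) :=
    star_dotProduct_mulVec_of_isHermitian (collectiveSpin_isHermitian Pauli.Z N) (ghzN N)
  rw [Complex.sub_re, hreal, ← Complex.ofReal_pow, Complex.ofReal_re, hv]
  ring

/-- **`I(ρ, Σ_j σ_l^{(j)}) ≤ (n−1)² + 1` for every biseparable state** (Chen's class bound `E_{n−1} = (n−1)² + 1`: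
«a state of `n` particles is fully entangled, if it cannot be written as `ρ_{(k)} ⊗ ρ_{(n−k)}` or mixtures of
these states»).  Road: `4I ≤ F_Q ≤ (N−1)² + 1` (Luo, Tóth (bisep-1)). [cite: Chen2005SkewInformationEntanglement,
eq. (13) with `E_{n−1} = (n−1)² + 1`] -/
theorem skewInfo_le_of_isBiseparable (l : Pauli) {ρ : Matrix (Fin N → Bool) (Fin N → Bool) ℂ}
    (hρ : IsBiseparable ρ) :
    ((ρ * ((∑ i : Fin N, localPauli l i) * (∑ i : Fin N, localPauli l i))).trace -
        (CFC.sqrt ρ * (∑ i : Fin N, localPauli l i) * CFC.sqrt ρ * (∑ i : Fin N, localPauli l i)).trace).re ≤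
      ((N : ℝ) - 1) ^ 2 + 1 := by
  have hρ0 := posSemidef_of_isBiseparable hρ
  obtain ⟨S, hS, hSρ⟩ := QFIVariance.exists_sld_unitaryDeriv hρ0 (collectiveSpin_isHermitian l N)
  exact (skewInfo_sum_localPauli_le_qfi l hρ0 hS hSρ).trans (qfi_le_of_isBiseparable l hρ hS hSρ)

/-- **«If `I(ρ) > (n−1)² + 1`, then `ρ` is fully entangled»** — here with the skew information of a collective
axis `Σ_j σ_l^{(j)}` as the witness and "fully entangled" = not biseparable (genuinely multipartite entangled,
BF Definition 18.5). [cite: Chen2005SkewInformationEntanglement, p. 3 (after the Classification theorem)] -/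
theorem not_isBiseparable_of_skewInfo_gt (l : Pauli) {ρ : Matrix (Fin N → Bool) (Fin N → Bool) ℂ}
    (hgt : ((N : ℝ) - 1) ^ 2 + 1 <
      ((ρ * ((∑ i : Fin N, localPauli l i) * (∑ i : Fin N, localPauli l i))).trace -
        (CFC.sqrt ρ * (∑ i : Fin N, localPauli l i) * CFC.sqrt ρ * (∑ i : Fin N, localPauli l i)).trace).re) :
    ¬ IsBiseparable ρ :=
  fun hρ => absurd (skewInfo_le_of_isBiseparable l hρ) (not_le.mpr hgt)

/-- **The GHZ state is fully entangled by the skew-information test** (`n ≥ 2`: `n² > (n−1)² + 1`; «Eq. (9) shows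
that `|GHZ⟩` is a fully entangled state»). [cite: Chen2005SkewInformationEntanglement, p. 3 (after eq. (14))] -/
theorem biseparable_bound_lt_skewInfo_ghzN (h2 : 2 ≤ N) :
    ((N : ℝ) - 1) ^ 2 + 1 <
      ((vecMulVec (ghzN N) (star (ghzN N)) * ((∑ i : Fin N, localPauli Pauli.Z i) * (∑ i : Fin N, localPauli Pauli.Z i))).trace -
        (CFC.sqrt (vecMulVec (ghzN N) (star (ghzN N))) * (∑ i : Fin N, localPauli Pauli.Z i) *
          CFC.sqrt (vecMulVec (ghzN N) (star (ghzN N))) * (∑ i : Fin N, localPauli Pauli.Z i)).trace).re := by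
  have : NeZero N := ⟨by omega⟩
  rw [skewInfo_ghzN]
  have h2' : (2 : ℝ) ≤ N := by exact_mod_cast h2
  nlinarith

end SkewInfoCriterion

end Literature.InformationTheory.Entanglement
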